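import Literature.NumberTheory.EllipticCurves.NeronComponentIndexTypeI0starProofs
import HarnessLib

/-!
# The parity of the local index `[E(K) : E₀(K)]` for the `I₀*`-shaped normal form (proofs)

`Proofs` file (theorems only: no definition, no named fact, no instance), topic
`Literature/NumberTheory/EllipticCurves`, sibling of `LocalIndexBadPoints.lean` and
`NeronComponentIndexTypeI0starProofs.lean`.

Let `R` be a discrete valuation ring with fraction field `K`, `ϖ` an irreducible element, and `J`
an equation over `R` in the shape of Step 6 of Tate's algorithm (Silverman, *ATAEC* IV.9.4):
`a₁ = ϖα`, `a₂ = ϖβ`, `a₃ = ϖ²γ`, `a₄ = ϖ²δ`, `a₆ = ϖ³ε`, with Step-6 cubic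
`P(T) = T³ + βT² + δT + ε`. The tree already knows that a point of `J(K)` outside `E₀(K)` lies over
a root of `P̄` in the residue field `k` (`LocalIndex.exists_root_of_not_hasNonsingularReduction`) and
that two bad points over the same SIMPLE root add into `E₀(K)`
(`LocalIndex.hasNonsingularReduction_add_of_same_root`). This file records the two parity
consequences used by Boxer–Diao, *2-Selmer groups of quadratic twists of elliptic curves*, Proc.
AMS 138 (2010), proof of Prop. 4.1 (p. 1977: "`c_p` is equal to `1` plus the number of roots of
the polynomial … mod `p`"; "`c_p = 2` or `4`"), WITHOUT assuming the three roots of `P̄` distinct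
(so that the same lemmas serve the types `I₀*` and `Iₙ*` alike):

* `LocalIndex.index_eq_one_of_forall_cubic_ne_zero` — if `P̄` has no root in `k` then
  `E(K) = E₀(K)`, i.e. the index is `1`;
* `LocalIndex.two_dvd_index_of_cubic_simple_root` — over a Henselian `R`, if `P̄` has a SIMPLE
  root in `k` then `2 ∣ [E(K) : E₀(K)]` (Hensel lifts the root to `T₀ ∈ R`, the point
  `(ϖT₀, 0)` is bad and twice it lies in `E₀(K)`, so its class has order `2` in `E(K)/E₀(K)`;
  when the index is infinite Mathlib's junk value `0` is even as well).

## References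

* J. H. Silverman, *Advanced Topics in the Arithmetic of Elliptic Curves*, GTM 151, Springer
  1994, IV.9.4 Steps 6–7 (PDF p. 345) and their proofs (PDF pp. 350–352). [SilvermanATAEC1994]
* G. Boxer, P. Diao, *2-Selmer groups of quadratic twists of elliptic curves*, Proc. Amer. Math.
  Soc. 138 (2010) 1969–1978, proof of Prop. 4.1 (p. 1977). [BoxerDiao2010]
-/

noncomputable section

open scoped Classical

open IsLocalRing

namespace Literature.NumberTheory.EllipticCurves

namespace LocalIndex

variable {R : Type*} [CommRing R] [IsDomain R] [IsDiscreteValuationRing R]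
  {K : Type*} [Field K] [Algebra R K] [IsFractionRing R K]

/-- **No root of the Step-6 cubic in `k` ⇒ `E(K) = E₀(K)`.** For `J` over `R` with `a₁ = ϖα`,
`a₂ = ϖβ`, `a₃ = ϖ²γ`, `a₄ = ϖ²δ`, `a₆ = ϖ³ε`: if `T³ + β̄T² + δ̄T + ε̄` has no root in the residue
field then every point of `J(K)` has nonsingular reduction, so `[E(K) : E₀(K)] = 1` (a bad point
would lie over a root, `exists_root_of_not_hasNonsingularReduction`). Boxer–Diao 2010, proof of
Prop. 4.1: "`c_p` is equal to `1` plus the number of roots … mod `p`", the case of no root.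
[cite: SilvermanATAEC1994, IV.9.4 Step 6 (PDF p. 345)] -/
theorem index_eq_one_of_forall_cubic_ne_zero (J : WeierstrassCurve R) {ϖ α β γ δ ε : R}
    (hϖ : Irreducible ϖ) (hα : J.a₁ = ϖ * α) (hβ : J.a₂ = ϖ * β) (hγ : J.a₃ = ϖ ^ 2 * γ)
    (hδ : J.a₄ = ϖ ^ 2 * δ) (hε : J.a₆ = ϖ ^ 3 * ε)
    (hno : ∀ t : ResidueField R,
      t ^ 3 + residue R β * t ^ 2 + residue R δ * t + residue R ε ≠ 0) :
    (J.nonsingularReductionSubgroup (integers_valuationRing_valuation R K)).index = 1 := by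
  rw [AddSubgroup.index_eq_one, eq_top_iff]
  intro P _
  rw [WeierstrassCurve.mem_nonsingularReductionSubgroup_iff]
  by_contra hP
  obtain ⟨x₁, y₂, h, -, he⟩ := exists_root_of_not_hasNonsingularReduction J hϖ hα hβ hγ hδ hε hP
  have hϖ0 : residue R ϖ = 0 :=
    (residue_eq_zero_iff _).mpr ((IsLocalRing.mem_maximalIdeal _).mpr hϖ.not_isUnit)
  have := congrArg (residue R) he
  simp only [map_add, map_mul, map_pow, hϖ0, zero_mul] at this
  exact hno (residue R x₁) this

/-- **A simple root of the Step-6 cubic in `k` ⇒ `2 ∣ [E(K) : E₀(K)]`** (Henselian `R`). For `J`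
over `R` with `a₁ = ϖα`, `a₂ = ϖβ`, `a₃ = ϖ²γ`, `a₄ = ϖ²δ`, `a₆ = ϖ³ε` and `Δ ≠ 0`: if
`t ∈ k` is a root of `T³ + β̄T² + δ̄T + ε̄` with `3t² + 2β̄t + δ̄ ≠ 0`, Hensel's lemma lifts it to
`T₀ ∈ R` with `T₀³ + βT₀² + δT₀ + ε = 0`; the point `(ϖT₀, 0) ∈ J(K)` reduces to the singular
point, and twice it lies in `E₀(K)` (`hasNonsingularReduction_add_of_same_root`), so its class in
`E(K)/E₀(K)` has order `2` and `2` divides the index (trivially so when the index is infinite,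
Mathlib's value `0`). Boxer–Diao 2010, proof of Prop. 4.1 (p. 1977): the cases "`c_p = 1 +`
number of roots" with a root, and "`c_p = 2` or `4`".
[cite: SilvermanATAEC1994, IV.9.4 Steps 6–7 (PDF p. 345)] -/
theorem two_dvd_index_of_cubic_simple_root [HenselianLocalRing R] (J : WeierstrassCurve R)
    {ϖ α β γ δ ε : R} (hϖ : Irreducible ϖ) (hα : J.a₁ = ϖ * α) (hβ : J.a₂ = ϖ * β)
    (hγ : J.a₃ = ϖ ^ 2 * γ) (hδ : J.a₄ = ϖ ^ 2 * δ) (hε : J.a₆ = ϖ ^ 3 * ε) (hΔ : J.Δ ≠ 0)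
    {t : ResidueField R} (ht : t ^ 3 + residue R β * t ^ 2 + residue R δ * t + residue R ε = 0)
    (ht' : 3 * t ^ 2 + 2 * residue R β * t + residue R δ ≠ 0) :
    2 ∣ (J.nonsingularReductionSubgroup (integers_valuationRing_valuation R K)).index := by
  -- Hensel: lift `t` to a root `T₀ ∈ R` of the monic cubic `T³ + βT² + δT + ε`
  obtain ⟨t₀, ht₀⟩ := residue_surjective t
  set f : Polynomial R := Polynomial.X ^ 3 + Polynomial.C β * Polynomial.X ^ 2 +
    Polynomial.C δ * Polynomial.X + Polynomial.C ε with hf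
  have hfm : f.Monic := by
    rw [hf]
    -- leading term `X ^ 3`
    have : (Polynomial.X ^ 3 + Polynomial.C β * Polynomial.X ^ 2 +
        Polynomial.C δ * Polynomial.X + Polynomial.C ε : Polynomial R) =
        Polynomial.X ^ 3 + (Polynomial.C β * Polynomial.X ^ 2 +
        Polynomial.C δ * Polynomial.X + Polynomial.C ε) := by ring
    rw [this]
    refine (Polynomial.monic_X_pow 3).add_of_left ?_
    refine (Polynomial.degree_add_le _ _).trans_lt (max_lt ((Polynomial.degree_add_le _ _).trans_lt
      (max_lt ?_ ?_)) ?_)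
    · exact (Polynomial.degree_C_mul_X_pow_le 2 β).trans_lt (by
        rw [Polynomial.degree_X_pow]; exact_mod_cast Nat.lt_succ_self 2)
    · exact (Polynomial.degree_C_mul_X_le δ).trans_lt (by
        rw [Polynomial.degree_X_pow]; exact_mod_cast (by norm_num : 1 < 3))
    · exact (Polynomial.degree_C_le).trans_lt (by
        rw [Polynomial.degree_X_pow]; exact_mod_cast (by norm_num : 0 < 3))
  have hev : ∀ s : R, f.eval s = s ^ 3 + β * s ^ 2 + δ * s + ε := by
    intro s; simp only [hf, Polynomial.eval_add, Polynomial.eval_mul, Polynomial.eval_C,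
      Polynomial.eval_pow, Polynomial.eval_X]
  have hev' : ∀ s : R, f.derivative.eval s = 3 * s ^ 2 + 2 * β * s + δ := by
    intro s
    simp [hf]
    ring
  have h₁ : f.eval t₀ ∈ maximalIdeal R := by
    rw [← residue_eq_zero_iff, hev]
    simp only [map_add, map_mul, map_pow, ht₀]
    exact ht
  have h₂ : IsUnit (f.derivative.eval t₀) := by
    rw [← residue_ne_zero_iff_isUnit, hev']
    simp only [map_add, map_mul, map_pow, map_ofNat, ht₀]
    exact ht'
  obtain ⟨T₀, hT₀, hT₀t⟩ := HenselianLocalRing.is_henselian f hfm t₀ h₁ h₂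
  have hroot : T₀ ^ 3 + β * T₀ ^ 2 + δ * T₀ + ε = 0 := by rw [← hev]; exact hT₀
  have hres : residue R T₀ = t := by
    rw [← ht₀, ← sub_eq_zero, ← map_sub, residue_eq_zero_iff]; exact hT₀t
  -- the bad point `P = (ϖT₀, 0)`
  have hϖ0 : ϖ ≠ 0 := hϖ.ne_zero
  have hinj := IsFractionRing.injective R K
  have heqR : J.toAffine.Equation (ϖ * T₀) (ϖ ^ 2 * 0) := by
    rw [WeierstrassCurve.Affine.equation_iff, hα, hβ, hγ, hδ, hε]
    linear_combination -(ϖ ^ 3) * hroot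
  have heq : (J.baseChange K).toAffine.Equation (algebraMap R K (ϖ * T₀))
      (algebraMap R K (ϖ ^ 2 * 0)) :=
    (WeierstrassCurve.Affine.map_equation _ hinj _ _).mpr heqR
  have hΔK : (J.baseChange K).Δ ≠ 0 := by
    rw [WeierstrassCurve.baseChange, WeierstrassCurve.map_Δ]
    exact (map_ne_zero_iff _ hinj).mpr hΔ
  have h : (J.baseChange K).toAffine.Nonsingular (algebraMap R K (ϖ * T₀))
      (algebraMap R K (ϖ ^ 2 * 0)) :=
    ((J.baseChange K).toAffine.equation_iff_nonsingular_of_Δ_ne_zero hΔK).mp heq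
  have hm : ϖ ∈ maximalIdeal R := (IsLocalRing.mem_maximalIdeal _).mpr hϖ.not_isUnit
  have h3 : J.a₃ ∈ maximalIdeal R :=
    hγ ▸ Ideal.mul_mem_right _ _ (Ideal.pow_mem_of_mem _ hm 2 two_pos)
  have h4 : J.a₄ ∈ maximalIdeal R :=
    hδ ▸ Ideal.mul_mem_right _ _ (Ideal.pow_mem_of_mem _ hm 2 two_pos)
  have hbad : ¬ J.HasNonsingularReduction (.some _ _ h) :=
    not_hasNonsingularReduction_some J h3 h4 (Ideal.mul_mem_right _ _ hm)
      (by rw [mul_zero]; exact zero_mem _) h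
  -- `2P ∈ E₀(K)`
  have h2P : J.HasNonsingularReduction
      (WeierstrassCurve.Affine.Point.some _ _ h + WeierstrassCurve.Affine.Point.some _ _ h) :=
    hasNonsingularReduction_add_of_same_root J hϖ hα hβ hγ hδ hε rfl (by rw [hres]; exact ht') h h
  -- the class of `P` has order `2` in `E(K)/E₀(K)`
  set H := J.nonsingularReductionSubgroup (integers_valuationRing_valuation R K) with hH
  set P : (J.baseChange K).toAffine.Point := WeierstrassCurve.Affine.Point.some _ _ h with hPdef
  have hPH : P ∉ H := by
    rw [hH, WeierstrassCurve.mem_nonsingularReductionSubgroup_iff]; exact hbad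
  have h2PH : P + P ∈ H := by
    rw [hH, WeierstrassCurve.mem_nonsingularReductionSubgroup_iff]; exact h2P
  have hq0 : (QuotientAddGroup.mk P : (J.baseChange K).toAffine.Point ⧸ H) ≠ 0 := by
    rw [Ne, QuotientAddGroup.eq_zero_iff]; exact hPH
  have hq2 : 2 • (QuotientAddGroup.mk P : (J.baseChange K).toAffine.Point ⧸ H) = 0 := by
    rw [← QuotientAddGroup.mk_nsmul, two_nsmul, QuotientAddGroup.eq_zero_iff]; exact h2PH
  have hord : addOrderOf (QuotientAddGroup.mk P : (J.baseChange K).toAffine.Point ⧸ H) = 2 :=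
    addOrderOf_eq_prime hq2 hq0
  rw [AddSubgroup.index, ← hord]
  exact addOrderOf_dvd_natCard _

end LocalIndex

end Literature.NumberTheory.EllipticCurves

end
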